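import Mathlib
import HarnessLib

/-!
# Line `taylor-model` on crux K1b-DR (`ExactWindowRungThree.DerivativeEnclosureCertificateR`,
# stmt-NavierStokesRegularity-23954) — readout stub G, helper 0a: Taylor and variational jets of a
# quadratic field

Helper file toward the registered stub `stub_readout : TaylorModelReadout` (S1 → K → K1b-DR) of the
line `taylor-model` (ideator ns-idea-2 g3, skeleton v3 `9391589be9c875b2`): the abstract soundness
statement S1 (`TaylorModelSoundness`) is quantified over GLOBAL jet maps `T x k` (Taylor coefficients of
the flow of `u' = Q(u,u)` at the base point `x`) and `U x v k` (coefficients of the first variation in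
the direction `v`) satisfying the Cauchy-product recursions
`(k+1) T x (k+1) = Σ_{i ≤ k} Q (T x i) (T x (k-i))`,
`(k+1) U x v (k+1) = Σ_{i ≤ k} (Q (T x i) (U x v (k-i)) + Q (U x v (k-i)) (T x i))`,
whereas the certificate record `TaylorChain.CertData` (Literature, p593471) carries FINITE jet tables
`P j s n`, `Wv j s n` at its centres obeying the same recursions up to the degree `pdeg`. This file
defines the global jets for any `Q : V → V → V` on a real vector space (`taylorJet`, `varJet`), proves
the recursions in the exact shape of S1's hypotheses (componentwise on `Fin n → ℝ`:
`taylorJet_succ_apply`, `varJet_succ_apply`), the uniqueness of solutions of the truncated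
recursions (`eq_taylorJet_of_rec`, `eq_varJet_of_rec`: a table obeying the recursion below degree `p`
IS the jet table up to `p`), and linearity of `varJet` in the direction for bilinear `Q`.
MODEL-lattice bookkeeping only (rung TL-M3 of the NS ladder); nothing here is a statement about the
Navier–Stokes equations.
-/

noncomputable section

-- the sub-problem namespace repeats the summit name by design (D-0017)
set_option linter.dupNamespace false

namespace Summit.NavierStokesRegularity.NavierStokesRegularity.Theorems.TaylorModelReadout

open scoped BigOperators
open Finset

variable {V : Type*} [AddCommGroup V] [Module ℝ V]

/-! ### Taylor jets of the centre trajectory -/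

/-- Auxiliary table: `jetTable Q x k i` is the `i`-th Taylor jet for `i ≤ k` (junk-free bookkeeping of
the course-of-values recursion). [folklore] -/
def jetTable (Q : V → V → V) (x : V) : ℕ → ℕ → V
  | 0 => fun _ => x
  | k + 1 => fun i => if i ≤ k then jetTable Q x k i
      else ((k : ℝ) + 1)⁻¹ • ∑ m ∈ range (k + 1), Q (jetTable Q x k m) (jetTable Q x k (k - m))

/-- The `k`-th Taylor jet `T x k` of the flow of `u' = Q(u,u)` at the base point `x`
(`u(s) = Σ_k T x k s^k` formally): `T x 0 = x`, `(k+1) T x (k+1) = Σ_{i≤k} Q (T x i) (T x (k-i))`.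
[folklore; cite: BerzMakino1998, §2 (Taylor expansion of the flow by the Picard/majorant recursion)] -/
def taylorJet (Q : V → V → V) (x : V) (k : ℕ) : V := jetTable Q x k k

variable (Q : V → V → V) (x : V)

/-- Entries of the table below the diagonal are the jets. [folklore] -/
theorem jetTable_of_le {k i : ℕ} (h : i ≤ k) : jetTable Q x k i = taylorJet Q x i := by
  induction k with
  | zero =>
    obtain rfl : i = 0 := Nat.le_zero.1 h
    rfl
  | succ k ih =>
    rcases Nat.lt_or_eq_of_le h with h1 | rfl
    · have hik : i ≤ k := Nat.lt_succ_iff.1 h1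
      have : jetTable Q x (k + 1) i = jetTable Q x k i := by
        simp only [jetTable, if_pos hik]
      rw [this, ih hik]
    · rfl

/-- `T x 0 = x`. [folklore] -/
@[simp] theorem taylorJet_zero : taylorJet Q x 0 = x := rfl

/-- The Cauchy-product recursion `(k+1) • T x (k+1) = Σ_{i ≤ k} Q (T x i) (T x (k-i))`. [folklore] -/
theorem taylorJet_succ (k : ℕ) :
    ((k : ℝ) + 1) • taylorJet Q x (k + 1) =
      ∑ m ∈ range (k + 1), Q (taylorJet Q x m) (taylorJet Q x (k - m)) := by
  have hk : ((k : ℝ) + 1) ≠ 0 := by positivity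
  have e : taylorJet Q x (k + 1) =
      ((k : ℝ) + 1)⁻¹ • ∑ m ∈ range (k + 1), Q (jetTable Q x k m) (jetTable Q x k (k - m)) := by
    simp only [taylorJet, jetTable, if_neg (Nat.lt_irrefl k ∘ Nat.lt_of_succ_le)]
  rw [e, smul_smul, mul_inv_cancel₀ hk, one_smul]
  refine sum_congr rfl fun m hm => ?_
  rw [jetTable_of_le Q x (Nat.lt_succ_iff.1 (mem_range.1 hm)), jetTable_of_le Q x (Nat.sub_le k m)]

/-- Componentwise form of the recursion on `Fin n → ℝ` — the exact shape of the jet hypothesis of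
`TaylorModelSoundness`. [folklore] -/
theorem taylorJet_succ_apply {n : ℕ} (Q : (Fin n → ℝ) → (Fin n → ℝ) → Fin n → ℝ)
    (x : Fin n → ℝ) (k : ℕ) (c : Fin n) :
    ((k : ℝ) + 1) * taylorJet Q x (k + 1) c =
      ∑ m ∈ range (k + 1), Q (taylorJet Q x m) (taylorJet Q x (k - m)) c := by
  have h := congrFun (taylorJet_succ Q x k) c
  rw [Pi.smul_apply, smul_eq_mul] at h
  rw [h, Finset.sum_apply]

/-- **Uniqueness of the truncated recursion**: a table `P` with `P 0 = x` obeying the Cauchy-product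
recursion for all `n < p` coincides with the jets up to order `p` (the certificate's jets `d.P j s`
are the true Taylor jets at the centre). [folklore] -/
theorem eq_taylorJet_of_rec {p : ℕ} {P : ℕ → V} (h0 : P 0 = x)
    (hrec : ∀ n, n < p → ((n : ℝ) + 1) • P (n + 1) = ∑ m ∈ range (n + 1), Q (P m) (P (n - m))) :
    ∀ n, n ≤ p → P n = taylorJet Q x n := by
  intro n
  induction n using Nat.strong_induction_on with
  | _ n ih =>
    intro hn
    cases n with
    | zero => simpa using h0
    | succ n =>
      have hnp : n < p := Nat.lt_of_succ_le hn
      have hk : ((n : ℝ) + 1) ≠ 0 := by positivity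
      have h1 := hrec n hnp
      have h2 := taylorJet_succ Q x n
      have hs : ∑ m ∈ range (n + 1), Q (P m) (P (n - m)) =
          ∑ m ∈ range (n + 1), Q (taylorJet Q x m) (taylorJet Q x (n - m)) := by
        refine sum_congr rfl fun m hm => ?_
        have hm' : m ≤ n := Nat.lt_succ_iff.1 (mem_range.1 hm)
        rw [ih m (Nat.lt_succ_of_le hm') (hm'.trans hnp.le),
          ih (n - m) (Nat.lt_succ_of_le (Nat.sub_le n m)) ((Nat.sub_le n m).trans hnp.le)]
      rw [hs, ← h2] at h1
      exact smul_right_injective V hk h1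

/-! ### Variational jets (first variation in a direction `v`) -/

/-- Auxiliary table for the variational jets. [folklore] -/
def varTable (Q : V → V → V) (x v : V) : ℕ → ℕ → V
  | 0 => fun _ => v
  | k + 1 => fun i => if i ≤ k then varTable Q x v k i
      else ((k : ℝ) + 1)⁻¹ • ∑ m ∈ range (k + 1),
        (Q (taylorJet Q x m) (varTable Q x v k (k - m)) + Q (varTable Q x v k (k - m)) (taylorJet Q x m))

/-- The `k`-th variational jet `U x v k` (Taylor coefficients of the first variation of the flow at `x`
in the direction `v`): `U x v 0 = v`,
`(k+1) U x v (k+1) = Σ_{i≤k} (Q (T x i) (U x v (k-i)) + Q (U x v (k-i)) (T x i))`.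
[folklore; cite: Zgliczynski2002C1Lohner, §3 (variational equation alongside the flow)] -/
def varJet (Q : V → V → V) (x v : V) (k : ℕ) : V := varTable Q x v k k

variable (v : V)

/-- Entries of the variational table below the diagonal are the variational jets. [folklore] -/
theorem varTable_of_le {k i : ℕ} (h : i ≤ k) : varTable Q x v k i = varJet Q x v i := by
  induction k with
  | zero =>
    obtain rfl : i = 0 := Nat.le_zero.1 h
    rfl
  | succ k ih =>
    rcases Nat.lt_or_eq_of_le h with h1 | rfl
    · have hik : i ≤ k := Nat.lt_succ_iff.1 h1
      have : varTable Q x v (k + 1) i = varTable Q x v k i := by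
        simp only [varTable, if_pos hik]
      rw [this, ih hik]
    · rfl

/-- `U x v 0 = v`. [folklore] -/
@[simp] theorem varJet_zero : varJet Q x v 0 = v := rfl

/-- The variational recursion
`(k+1) • U x v (k+1) = Σ_{i≤k} (Q (T x i) (U x v (k-i)) + Q (U x v (k-i)) (T x i))`. [folklore] -/
theorem varJet_succ (k : ℕ) :
    ((k : ℝ) + 1) • varJet Q x v (k + 1) =
      ∑ m ∈ range (k + 1),
        (Q (taylorJet Q x m) (varJet Q x v (k - m)) + Q (varJet Q x v (k - m)) (taylorJet Q x m)) := by
  have hk : ((k : ℝ) + 1) ≠ 0 := by positivity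
  have e : varJet Q x v (k + 1) =
      ((k : ℝ) + 1)⁻¹ • ∑ m ∈ range (k + 1),
        (Q (taylorJet Q x m) (varTable Q x v k (k - m)) +
          Q (varTable Q x v k (k - m)) (taylorJet Q x m)) := by
    simp only [varJet, varTable, if_neg (Nat.lt_irrefl k ∘ Nat.lt_of_succ_le)]
  rw [e, smul_smul, mul_inv_cancel₀ hk, one_smul]
  refine sum_congr rfl fun m _ => ?_
  rw [varTable_of_le Q x v (Nat.sub_le k m)]

/-- Componentwise form of the variational recursion on `Fin n → ℝ` — the exact shape of the
variational-jet hypothesis of `TaylorModelSoundness`. [folklore] -/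
theorem varJet_succ_apply {n : ℕ} (Q : (Fin n → ℝ) → (Fin n → ℝ) → Fin n → ℝ)
    (x v : Fin n → ℝ) (k : ℕ) (c : Fin n) :
    ((k : ℝ) + 1) * varJet Q x v (k + 1) c =
      ∑ m ∈ range (k + 1),
        (Q (taylorJet Q x m) (varJet Q x v (k - m)) c + Q (varJet Q x v (k - m)) (taylorJet Q x m) c) := by
  have h := congrFun (varJet_succ Q x v k) c
  rw [Pi.smul_apply, smul_eq_mul] at h
  rw [h, Finset.sum_apply]
  rfl

/-- **Uniqueness of the truncated variational recursion**: a table `W` with `W 0 = v` obeying the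
variational recursion (with the true jets `T x`) for all `n < p` is the variational jet table up to
order `p`. [folklore] -/
theorem eq_varJet_of_rec {p : ℕ} {W : ℕ → V} (h0 : W 0 = v)
    (hrec : ∀ n, n < p → ((n : ℝ) + 1) • W (n + 1) =
      ∑ m ∈ range (n + 1), (Q (taylorJet Q x m) (W (n - m)) + Q (W (n - m)) (taylorJet Q x m))) :
    ∀ n, n ≤ p → W n = varJet Q x v n := by
  intro n
  induction n using Nat.strong_induction_on with
  | _ n ih =>
    intro hn
    cases n with
    | zero => simpa using h0
    | succ n =>
      have hnp : n < p := Nat.lt_of_succ_le hn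
      have hk : ((n : ℝ) + 1) ≠ 0 := by positivity
      have h1 := hrec n hnp
      have h2 := varJet_succ Q x v n
      have hs : ∑ m ∈ range (n + 1), (Q (taylorJet Q x m) (W (n - m)) + Q (W (n - m)) (taylorJet Q x m)) =
          ∑ m ∈ range (n + 1),
            (Q (taylorJet Q x m) (varJet Q x v (n - m)) + Q (varJet Q x v (n - m)) (taylorJet Q x m)) := by
        refine sum_congr rfl fun m _ => ?_
        rw [ih (n - m) (Nat.lt_succ_of_le (Nat.sub_le n m)) ((Nat.sub_le n m).trans hnp.le)]
      rw [hs, ← h2] at h1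
      exact smul_right_injective V hk h1

/-! ### Linearity of the variational jets in the direction -/

/-- For `Q` additive in each argument, `U x (v + v') k = U x v k + U x v' k`. [folklore] -/
theorem varJet_add (hQl : ∀ a b b', Q a (b + b') = Q a b + Q a b')
    (hQr : ∀ a a' b, Q (a + a') b = Q a b + Q a' b) (v v' : V) :
    ∀ k, varJet Q x (v + v') k = varJet Q x v k + varJet Q x v' k := by
  intro k
  induction k using Nat.strong_induction_on with
  | _ k ih =>
    cases k with
    | zero => simp
    | succ k =>
      have hk : ((k : ℝ) + 1) ≠ 0 := by positivity
      apply smul_right_injective V hk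
      simp only
      rw [smul_add, varJet_succ, varJet_succ, varJet_succ, ← sum_add_distrib]
      refine sum_congr rfl fun m _ => ?_
      rw [ih (k - m) (Nat.lt_succ_of_le (Nat.sub_le k m)), hQl, hQr]
      abel

/-- For `Q` homogeneous in each argument, `U x (a • v) k = a • U x v k`. [folklore] -/
theorem varJet_smul (hQl : ∀ (r : ℝ) a b, Q a (r • b) = r • Q a b)
    (hQr : ∀ (r : ℝ) a b, Q (r • a) b = r • Q a b) (r : ℝ) (v : V) :
    ∀ k, varJet Q x (r • v) k = r • varJet Q x v k := by
  intro k
  induction k using Nat.strong_induction_on with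
  | _ k ih =>
    cases k with
    | zero => simp
    | succ k =>
      have hk : ((k : ℝ) + 1) ≠ 0 := by positivity
      apply smul_right_injective V hk
      simp only
      rw [smul_comm, varJet_succ, varJet_succ, smul_sum]
      refine sum_congr rfl fun m _ => ?_
      rw [ih (k - m) (Nat.lt_succ_of_le (Nat.sub_le k m)), hQl, hQr, smul_add]

end Summit.NavierStokesRegularity.NavierStokesRegularity.Theorems.TaylorModelReadout

end
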